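import Mathlib
import Summits.ValiantsHypothesis.ValiantsHypothesis.Theorems.GeneratorObstructionsPowGenDegreeQPQuadricGenTypes
import Summits.ValiantsHypothesis.ValiantsHypothesis.Theorems.GeneratorObstructionsPerGenDegreeSuperQPAmbientTransfer

/-!
# K2 `PowGenDegreeQP` (stmt-ValiantsHypothesis-11655), line `trace-side-regimes`:
# the own-letter Chow test — bottom row `m = 2` and the ambient necessary condition

Helper file (`--supports stmt-ValiantsHypothesis-11655`), companion of
`GeneratorObstructionsPowGenDegreeQPChowOwnLetters` (this session): there the decisive Chow test of
both leaves (`chowLate_dichotomy`: late generators of the Chow covariant algebra ⟹ K1 ∧ ¬K2) was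
reduced by name to the covariant algebra `A(Δ_{GL_m}(x₀⋯x_{m-1}))` of the Chow variety `Ch_m(ℂ^m)`
in its own `m` letters ("ChowLateOwn").  Two calibrations of that statement:

* `linSubstRep_hadamard_prod_X_two`, `chowOwn_two_genType_iff` — ROW `m = 2`: `x₀x₁` is a
  full-rank binary quadric (`(x₀+x₁)(x₀-x₁) = x₀² - x₁²`), so by the tree's two-sided description of
  the generator types of full-rank quadrics (`genType_iff_fundamental_of_linSubstRep_eq_diagonal`,
  row `m = 2` of K2) the generator types of `A(Ch_2(ℂ²)) = ℂ[Sym² ℂ²]^U` are exactly `0`, `(0,-2)`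
  (the form, degree 1) and `(-2,-2)` (the discriminant, degree 2): `chowOwn_two_degree_le` — every
  generator type has `-|χ| ≤ 4 = 2·m`, so the own-letter Chow test has no witness in row `m = 2` for
  any exponent `c` (`chowOwn_two_not_late`), exactly like K2's closed rows `m ≤ 2`.
* `lateAmbientOwn_of_chowLateOwn` — a NECESSARY condition: by the tree's
  `gamma_orbitClosure_le_gamma_ambient` (Derksen–Makam 2020 Lemma 1.3: the quotient map
  `ℂ[Sym^m ℂ^m] ↠ ℂ[Ch_m(ℂ^m)]` can only lose generators), late own-letter Chow generators force late
  minimal generators OF THE SAME TYPE in the classical algebra of covariants of `m`-ary `m`-ics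
  `ℂ[Sym^m ℂ^m]^U` — for `m = 3` Gordan's ternary cubics, for `m = 4` quaternary quartics.  So the
  Chow route to `K1 ∧ ¬K2` needs super-quasi-polynomial generation degree of `Cov(Sym^m ℂ^m)` along
  a subsequence of `m`, a statement of classical invariant theory with only exponential UPPER
  bounds in print (Jordan, Popov, Derksen) and no super-polynomial lower bound.

Honest framing: bottom-row calibration and a necessary condition; `stub_sliceGen`, `stub_wideGen`,
K1, K2 and the Chow test remain OPEN; `VP ≠ VNP` is not touched.

References: Goodman–Wallach §5.7 (`k[Sym²]^U`); Derksen–Makam 2020 Lemma 1.3; Landsberg 2017 §9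
(Chow variety, Hermite reciprocity `Ch_m(ℂ²) = Sym^m ℂ²`).  No new definitions.
-/

namespace Summit.ValiantsHypothesis.ValiantsHypothesis.Theorems.GeneratorObstructions.PowGenDegreeQP

open MvPolynomial
open Literature.NumberTheory.DiophantineGeometry Literature.Computability.AlgebraicComplexity
open Summit.ValiantsHypothesis.ValiantsHypothesis.Theses.GeneratorObstructions
open Summit.ValiantsHypothesis.ValiantsHypothesis.Theorems.GeneratorObstructions.PerGenDegreeSuperQP

-- `Summit.ValiantsHypothesis.ValiantsHypothesis.…` is the tree's mandated single-conjunct layout.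
set_option linter.dupNamespace false

noncomputable section

/-! ## 1. Row `m = 2` of the own-letter Chow test -/

section RowTwo

/-- The Hadamard matrix `[[1,1],[1,-1]]` has determinant `-2 ≠ 0` over `ℂ`. [folklore] -/
theorem det_hadamardTwo_ne_zero : (!![(1 : ℂ), 1; 1, -1]).det ≠ 0 := by
  rw [Matrix.det_fin_two_of]
  norm_num

/-- **`x₀x₁` is a full-rank binary quadric**: the substitution `x₀ ↦ x₀ + x₁`, `x₁ ↦ x₀ - x₁`
(the Hadamard matrix, an element of `GL_2(ℂ)`) carries `x₀x₁` to `x₀² - x₁²`. [folklore] -/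
theorem linSubstRep_hadamard_prod_X_two :
    linSubstRep (Fin 2) ℂ (Matrix.GeneralLinearGroup.mkOfDetNeZero _ det_hadamardTwo_ne_zero)
        (∏ i : Fin 2, (X i : MvPolynomial (Fin 2) ℂ)) =
      ∑ u : Fin 2, (fun u : Fin 2 => if u = 0 then (1 : ℂ) else -1) u • (X u : MvPolynomial (Fin 2) ℂ) ^ 2 := by
  rw [linSubstRep_apply, Fin.prod_univ_two, map_mul, linSubst_X, linSubst_X, Fin.sum_univ_two,
    Fin.sum_univ_two, Fin.sum_univ_two]
  simp only [Matrix.GeneralLinearGroup.val_mkOfDetNeZero, Matrix.of_apply, Matrix.cons_val',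
    Matrix.cons_val_zero, Matrix.cons_val_one, Matrix.empty_val', Matrix.cons_val_fin_one,
    Fin.isValue, one_smul, neg_smul, Fin.one_eq_zero_iff, OfNat.ofNat_ne_one, if_true, if_false]
  ring

/-- **Generator types of `A(Ch_2(ℂ²))`.**  The covariant algebra of the Chow variety of binary
quadrics `Δ_{GL_2}(x₀x₁) = Sym² ℂ²` (every binary quadric splits) has exactly the generator types
`0` (degenerate), `(0,-2)` (the form itself, degree 1) and `(-2,-2)` (the discriminant, degree 2):
`γ_χ ≠ 0 ⟺ χ = 0 ∨ χ = -2·𝟙_{≥ t}`, `t ∈ {0,1}`.  Row `m = 2` machinery of K2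
(`genType_iff_fundamental_of_linSubstRep_eq_diagonal`) applied to `linSubstRep_hadamard_prod_X_two`.
[folklore] -/
theorem chowOwn_two_genType_iff (χ : Weight (Fin 2)) :
    Module.finrank ℂ (↥(highestWeightSpace (orbitCoordRep (∏ i : Fin 2, (X i : MvPolynomial (Fin 2) ℂ)) 2) χ) ⧸ Submodule.comap (highestWeightSpace (orbitCoordRep (∏ i : Fin 2, (X i : MvPolynomial (Fin 2) ℂ)) 2) χ).subtype (⨆ p : Weight (Fin 2) × Weight (Fin 2), ⨆ (_ : p.1 + p.2 = χ ∧ p.1 ≠ 0 ∧ p.2 ≠ 0), highestWeightSpace (orbitCoordRep (∏ i : Fin 2, (X i : MvPolynomial (Fin 2) ℂ)) 2) p.1 * highestWeightSpace (orbitCoordRep (∏ i : Fin 2, (X i : MvPolynomial (Fin 2) ℂ)) 2) p.2)) ≠ 0 ↔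
    χ = 0 ∨ ∃ t : Fin 2, χ = fun v => if t ≤ v then (-2 : ℤ) else 0 :=
  genType_iff_fundamental_of_linSubstRep_eq_diagonal _ _ (fun u : Fin 2 => if u = 0 then (1 : ℂ) else -1)
    (fun u => by
      by_cases hu : u = 0
      · simp [hu]
      · simp [hu])
    linSubstRep_hadamard_prod_X_two χ

/-- **Row `m = 2` of the own-letter Chow test is bounded by `2·m`**: every generator type `χ` of
`A(Ch_2(ℂ²))` has `-|χ| ≤ 4` (degrees `0, 1, 2`). [folklore] -/
theorem chowOwn_two_degree_le (χ : Weight (Fin 2))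
    (h : Module.finrank ℂ (↥(highestWeightSpace (orbitCoordRep (∏ i : Fin 2, (X i : MvPolynomial (Fin 2) ℂ)) 2) χ) ⧸ Submodule.comap (highestWeightSpace (orbitCoordRep (∏ i : Fin 2, (X i : MvPolynomial (Fin 2) ℂ)) 2) χ).subtype (⨆ p : Weight (Fin 2) × Weight (Fin 2), ⨆ (_ : p.1 + p.2 = χ ∧ p.1 ≠ 0 ∧ p.2 ≠ 0), highestWeightSpace (orbitCoordRep (∏ i : Fin 2, (X i : MvPolynomial (Fin 2) ℂ)) 2) p.1 * highestWeightSpace (orbitCoordRep (∏ i : Fin 2, (X i : MvPolynomial (Fin 2) ℂ)) 2) p.2)) ≠ 0) :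
    -(Weight.size χ) ≤ 4 := by
  rcases (chowOwn_two_genType_iff χ).mp h with rfl | ⟨t, rfl⟩
  · simp [Weight.size]
  · rw [Weight.size, Fin.sum_univ_two]
    fin_cases t <;> simp

/-- **No own-letter Chow witness in row `m = 2`**, for any exponent `c`: the bound
`-|χ| ≤ 2 · 2^((log₂ 2 + c)^c)` holds for every generator type (`2^((1+c)^c) ≥ 2`). [folklore] -/
theorem chowOwn_two_not_late (c : ℕ) (χ : Weight (Fin 2))
    (h : Module.finrank ℂ (↥(highestWeightSpace (orbitCoordRep (∏ i : Fin 2, (X i : MvPolynomial (Fin 2) ℂ)) 2) χ) ⧸ Submodule.comap (highestWeightSpace (orbitCoordRep (∏ i : Fin 2, (X i : MvPolynomial (Fin 2) ℂ)) 2) χ).subtype (⨆ p : Weight (Fin 2) × Weight (Fin 2), ⨆ (_ : p.1 + p.2 = χ ∧ p.1 ≠ 0 ∧ p.2 ≠ 0), highestWeightSpace (orbitCoordRep (∏ i : Fin 2, (X i : MvPolynomial (Fin 2) ℂ)) 2) p.1 * highestWeightSpace (orbitCoordRep (∏ i : Fin 2, (X i : MvPolynomial (Fin 2) ℂ)) 2)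 p.2)) ≠ 0) :
    -(Weight.size χ) ≤ (2 : ℤ) * 2 ^ ((Nat.log 2 2 + c) ^ c) := by
  have h4 := chowOwn_two_degree_le χ h
  have hpow : (2 : ℤ) ≤ 2 ^ ((Nat.log 2 2 + c) ^ c) := by
    have h1 : 1 ≤ (Nat.log 2 2 + c) ^ c :=
      Nat.one_le_pow _ _ (Nat.add_pos_left (Nat.log_pos one_lt_two le_rfl) c)
    calc (2 : ℤ) = 2 ^ 1 := by norm_num
      _ ≤ 2 ^ ((Nat.log 2 2 + c) ^ c) := pow_le_pow_right₀ (by norm_num) h1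
  linarith

end RowTwo

/-! ## 2. The ambient necessary condition: covariants of `m`-ary `m`-ics -/

section Ambient

/-- **Late own-letter Chow generators force late classical covariants of `m`-ary `m`-ics.**  If
for every `c` and cofinally in `m` the covariant algebra of `Ch_m(ℂ^m) = Δ_{GL_m}(x₀⋯x_{m-1})` has a
generator type `χ` with `-|χ| > m · 2^((log₂ m + c)^c)`, then so does — at the SAME weight — the
algebra of covariants `ℂ[Sym^m ℂ^m]^U` of `m`-ary forms of degree `m` (highest-weight vectors of
the polynomial ring on `Sym^m ℂ^m` modulo products): the quotient map onto `ℂ[Ch_m(ℂ^m)]` is a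
`GL_m`-equivariant algebra surjection out of a completely reducible module, so `γ_χ(Ch_m) ≤
γ_χ(ℂ[Sym^m ℂ^m])` (tree `gamma_orbitClosure_le_gamma_ambient`, Derksen–Makam 2020 Lemma 1.3).
[cite: DerksenMakam2020, Lemma 1.3] -/
theorem lateAmbientOwn_of_chowLateOwn
    (hC : ∀ c m₀ : ℕ, ∃ m : ℕ, m₀ ≤ m ∧ ∃ χ : Weight (Fin m),
      Module.finrank ℂ (↥(highestWeightSpace (orbitCoordRep (∏ i : Fin m, (X i : MvPolynomial (Fin m) ℂ)) m) χ) ⧸ Submodule.comap (highestWeightSpace (orbitCoordRep (∏ i : Fin m, (X i : MvPolynomial (Fin m) ℂ)) m) χ).subtype (⨆ p : Weight (Fin m) × Weight (Fin m), ⨆ (_ : p.1 + p.2 = χ ∧ p.1 ≠ 0 ∧ p.2 ≠ 0), highestWeightSpace (orbitCoordRep (∏ i : Fin m, (X i : MvPolynomial (Fin m) ℂ)) m) p.1 * highestWeightSpace (orbitCoordRep (∏ i : Fin m, (X i : MvPolynomial (Fin m) ℂ)) m) p.2)) ≠ 0 ∧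
        (m : ℤ) * 2 ^ ((Nat.log 2 m + c) ^ c) < -(Weight.size χ)) :
    ∀ c m₀ : ℕ, ∃ m : ℕ, m₀ ≤ m ∧ 1 ≤ m ∧ ∃ χ : Weight (Fin m),
      Module.finrank ℂ (↥(highestWeightSpace (coordRep (Fin m) ℂ m) χ) ⧸ Submodule.comap (highestWeightSpace (coordRep (Fin m) ℂ m) χ).subtype (⨆ p : Weight (Fin m) × Weight (Fin m), ⨆ (_ : p.1 + p.2 = χ ∧ p.1 ≠ 0 ∧ p.2 ≠ 0), highestWeightSpace (coordRep (Fin m) ℂ m) p.1 * highestWeightSpace (coordRep (Fin m) ℂ m) p.2)) ≠ 0 ∧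
        (m : ℤ) * 2 ^ ((Nat.log 2 m + c) ^ c) < -(Weight.size χ) := by
  intro c m₀
  obtain ⟨m, hm, χ, hγ, hlt⟩ := hC c (max m₀ 1)
  have h1m : 1 ≤ m := le_trans (le_max_right _ _) hm
  refine ⟨m, le_trans (le_max_left _ _) hm, h1m, χ, ?_, hlt⟩
  intro h0
  exact hγ (Nat.eq_zero_of_le_zero
    (h0 ▸ gamma_orbitClosure_le_gamma_ambient (σ := Fin m) (∏ i : Fin m, (X i : MvPolynomial (Fin m) ℂ))
      (n := m) (by omega) χ))

end Ambient

end

end Summit.ValiantsHypothesis.ValiantsHypothesis.Theorems.GeneratorObstructions.PowGenDegreeQP
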